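import Mathlib
import HarnessLib
import Literature.NumberTheory.Sieve.IwaniecAlmostPrimesProp1Corollary
import Literature.NumberTheory.LFunctions.ExceptionalZeroPrimeSums

/-!
# Crux `SplitBlockJacobi` (stmt-Parity-11583, route `IsogenyRedei`), line `split-mass-middle-prime`:
# the digit reparametrisation (`stub_digitReparametrisation`)

The DICTIONARY stub: cancellation of the FACTORED middle sum (in `(Q, ν, s)`-currency) implies
cancellation of the MIDDLE-PRIME Jacobi sum `M_{θ,θ′}(x) = Σ_{t ≤ x} Σ_{Q<Q′ ∈ pf(t²+1),
x^θ<Q≤x^{θ′}} (Q|Q′)`.  Elementary: for `x ≥ 4`, `1/2 < θ`, `θ′ ≤ 1`, exchange `Σ_t`, `Σ_Q`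
(`middle_inner_eq`); for each prime `Q` reindex `{t ≤ x : Q ∣ t²+1}` by `t = ν + Qs`, `ν = t mod Q`
(`sum_filter_Icc_eq_sum_roots`); termwise, with `t²+1 = Q·R`, `R = Q′·m`, `Q ∤ R`:
`(Q|Q′) = (Q′|Q)` (reciprocity: `Q`, an odd prime factor of `ν²+1`, is `≡ 1 (mod 4)`)
`= (R|Q)(m|Q)` (`(m|Q)² = 1`) `= (c_ν + 2νs | Q)(m|Q)` (`R = c_ν + 2νs + Qs²`), and
`pf(t²+1) ∩ (Q,∞) = pf(R) ∩ (Q,∞)` (`inner_sum_eq`).  On the exceptional set `Q ∣ R` both summands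
are `≤ 3` in size (`Q > x^θ > √x`, so `t²+1 < Q⁴`), and as `x < Q²` at most `ρ(Q²) ≤ 2` values
`t ≤ x` are exceptional (tree: `Iwaniec1978.card_filter_Ico_dvd_sq_add_one`, `rho_primePow_le_two`).
Hence `|M(x) − factored(x)| ≤ 12·#F ≤ 12 (x^{θ′} + 1)`, and `x^{θ′} = o(x)`.  `1/2 < θ` is used
exactly in `x < Q²`.
-/

noncomputable section

open Filter Finset Asymptotics
open Literature.NumberTheory.LFunctions.SiegelZero (abs_jacobiSym_cast_le_one)
open scoped Classical

namespace Summit.Parity.BatemanHorn.Cruxes.SplitBlockJacobi.SplitMassMiddlePrime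

namespace DigitReparam

/-- `Q ∣ (ν + Qs)² + 1 ↔ Q ∣ ν² + 1`. [folklore] -/
theorem dvd_sq_add_one_iff (Q ν s : ℕ) : Q ∣ (ν + Q * s) ^ 2 + 1 ↔ Q ∣ ν ^ 2 + 1 := by
  rw [show (ν + Q * s) ^ 2 + 1 = Q * (2 * ν * s + Q * s ^ 2) + (ν ^ 2 + 1) by ring]
  exact Nat.dvd_add_right (dvd_mul_right Q _)

/-- The second `Q`-adic digit: `((ν + Qs)² + 1)/Q = (ν² + 1)/Q + 2νs + Qs²`. [folklore] -/
theorem sq_add_one_div_eq {Q : ℕ} (hQ : 0 < Q) (ν s : ℕ) :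
    ((ν + Q * s) ^ 2 + 1) / Q = (ν ^ 2 + 1) / Q + 2 * ν * s + Q * s ^ 2 := by
  rw [show (ν + Q * s) ^ 2 + 1 = (ν ^ 2 + 1) + Q * (2 * ν * s + Q * s ^ 2) by ring,
    Nat.add_mul_div_left _ _ hQ, add_assoc]

/-- An odd prime factor of `ν² + 1` is `≡ 1 (mod 4)`. [folklore] -/
theorem mod_four_eq_one_of_dvd {Q ν : ℕ} (hQ : Q.Prime) (hQ2 : Q ≠ 2) (hd : Q ∣ ν ^ 2 + 1) :
    Q % 4 = 1 := by
  haveI := Fact.mk hQ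
  have h0 : ((ν ^ 2 + 1 : ℕ) : ZMod Q) = 0 := (ZMod.natCast_eq_zero_iff _ _).mpr hd
  push_cast at h0
  have h3 := ZMod.mod_four_ne_three_of_sq_eq_neg_one (eq_neg_of_add_eq_zero_left h0)
  exact (Nat.odd_mod_four_iff.mp (Nat.odd_iff.mp (hQ.odd_of_ne_two hQ2))).resolve_right h3

/-- If `n < Q⁴` (`Q ≥ 2`) then `n` has at most three prime factors `> Q`. [folklore] -/
theorem card_filter_primeFactors_le_three {Q n : ℕ} (hQ : 2 ≤ Q) (hn : n < Q ^ 4) :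
    ((n.primeFactors).filter (fun Q' : ℕ => Q < Q')).card ≤ 3 := by
  rcases Nat.eq_zero_or_pos n with rfl | hn0
  · simp
  set S := (n.primeFactors).filter (fun Q' : ℕ => Q < Q')
  by_contra hlt
  push Not at hlt
  have h1 : Q ^ S.card ≤ ∏ p ∈ S, p :=
    Finset.pow_card_le_prod _ (fun p => p) Q fun p hp => (Finset.mem_filter.mp hp).2.le
  have h2 : ∏ p ∈ S, p ∣ n :=
    (Finset.prod_dvd_prod_of_subset _ _ _ (Finset.filter_subset _ _)).trans
      (Nat.prod_primeFactors_dvd n)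
  have h3 : Q ^ 4 ≤ Q ^ S.card := Nat.pow_le_pow_right (by omega) hlt
  linarith [Nat.le_of_dvd hn0 h2]

/-- For a prime `Q ∣ n`, the prime factors `> Q` of `n` and of `n/Q` coincide. [folklore] -/
theorem filter_primeFactors_div {Q n : ℕ} (hQ : Q.Prime) (hQn : Q ∣ n) :
    (n.primeFactors).filter (fun Q' : ℕ => Q < Q') =
      ((n / Q).primeFactors).filter (fun Q' : ℕ => Q < Q') := by
  rcases Nat.eq_zero_or_pos n with rfl | hn0
  · simp
  have hR0 : n / Q ≠ 0 := (Nat.div_pos (Nat.le_of_dvd hn0 hQn) hQ.pos).ne'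
  ext Q'
  simp only [Finset.mem_filter, Nat.mem_primeFactors]
  constructor
  · rintro ⟨⟨hp, hd, -⟩, hlt⟩
    refine ⟨⟨hp, ?_, hR0⟩, hlt⟩
    rw [← Nat.mul_div_cancel' hQn] at hd
    exact ((Nat.coprime_primes hp hQ).mpr hlt.ne').dvd_mul_left.mp hd
  · rintro ⟨⟨hp, hd, -⟩, hlt⟩
    exact ⟨⟨hp, hd.trans (Nat.div_dvd_of_dvd hQn), hn0.ne'⟩, hlt⟩

/-- **The dictionary, termwise.** For an odd prime `Q`, `Q ∣ ν²+1`, `t = ν + Qs`, `n = t²+1`,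
`R = n/Q` with `Q ∤ R`:
`Σ_{Q′ ∈ pf(n), Q′ > Q} (Q|Q′) = (c_ν + 2νs | Q) · Σ_{Q′ ∈ pf(R), Q′ > Q} (R/Q′ | Q)`
(reciprocity for `Q ≡ 1 (mod 4)`, multiplicativity, `(m|Q)² = 1`, periodicity).
[folklore] -/
theorem inner_sum_eq {Q ν s : ℕ} (hQ : Q.Prime) (hQ2 : Q ≠ 2) (hν : Q ∣ ν ^ 2 + 1)
    (hex : ¬ Q ∣ ((ν + Q * s) ^ 2 + 1) / Q) :
    ∑ Q' ∈ (((ν + Q * s) ^ 2 + 1).primeFactors).filter (fun Q' : ℕ => Q < Q'),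
        (jacobiSym (Q : ℤ) Q' : ℝ) =
      (jacobiSym (((ν ^ 2 + 1) / Q + 2 * ν * s : ℕ) : ℤ) Q : ℝ) *
        ∑ Q' ∈ ((((ν + Q * s) ^ 2 + 1) / Q).primeFactors).filter (fun Q' : ℕ => Q < Q'),
          (jacobiSym ((((ν + Q * s) ^ 2 + 1) / Q / Q' : ℕ) : ℤ) Q : ℝ) := by
  have hQn : Q ∣ (ν + Q * s) ^ 2 + 1 := (dvd_sq_add_one_iff Q ν s).mpr hν
  have hQ4 : Q % 4 = 1 := mod_four_eq_one_of_dvd hQ hQ2 hν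
  rw [filter_primeFactors_div hQ hQn, Finset.mul_sum]
  refine Finset.sum_congr rfl fun Q' hQ' => ?_
  obtain ⟨hQ'mem, hlt⟩ := Finset.mem_filter.mp hQ'
  obtain ⟨hp, hd, -⟩ := Nat.mem_primeFactors.mp hQ'mem
  set R := ((ν + Q * s) ^ 2 + 1) / Q with hR
  have hRmod : jacobiSym (R : ℤ) Q = jacobiSym (((ν ^ 2 + 1) / Q + 2 * ν * s : ℕ) : ℤ) Q := by
    apply jacobiSym.mod_left'
    rw [hR, sq_add_one_div_eq hQ.pos]
    push_cast
    exact Int.add_mul_emod_self_left _ _ _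
  set m := R / Q' with hm
  have hRm : R = Q' * m := (Nat.mul_div_cancel' hd).symm
  have hndvd : ¬ Q ∣ m := fun h => hex (h.trans (Nat.div_dvd_of_dvd hd))
  have hgcd : Int.gcd (m : ℤ) Q = 1 := by
    rw [Int.gcd_natCast_natCast]
    exact Nat.coprime_comm.mp ((Nat.Prime.coprime_iff_not_dvd hQ).mpr hndvd)
  have hmul : jacobiSym (R : ℤ) Q = jacobiSym (Q' : ℤ) Q * jacobiSym (m : ℤ) Q := by
    rw [hRm, Nat.cast_mul, jacobiSym.mul_left]
  have hQ'odd : Odd Q' := hp.odd_of_ne_two (by have := hQ.two_le; omega)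
  have key : jacobiSym (Q : ℤ) Q' =
      jacobiSym (((ν ^ 2 + 1) / Q + 2 * ν * s : ℕ) : ℤ) Q * jacobiSym (m : ℤ) Q := by
    rw [jacobiSym.quadratic_reciprocity_one_mod_four hQ4 hQ'odd, ← hRmod, hmul, mul_assoc, ← sq,
      jacobiSym.sq_one hgcd, mul_one]
  exact_mod_cast key

/-- A sum of at most three terms of absolute value `≤ 1` is `≤ 3` in absolute value. [folklore] -/
theorem abs_sum_le_three {S : Finset ℕ} {f : ℕ → ℝ} (hf : ∀ i, |f i| ≤ 1) (hS : S.card ≤ 3) :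
    |∑ i ∈ S, f i| ≤ 3 :=
  calc |∑ i ∈ S, f i| ≤ ∑ i ∈ S, |f i| := Finset.abs_sum_le_sum_abs _ _
    _ ≤ ∑ _i ∈ S, (1 : ℝ) := Finset.sum_le_sum fun i _ => hf i
    _ ≤ 3 := by rw [Finset.sum_const, nsmul_eq_mul, mul_one]; exact_mod_cast hS

/-- **The dictionary with its exceptional set.** For an odd prime `Q` with `x < Q²`, a root
`ν` (`Q ∣ ν²+1`, `ν < Q`) and `s` with `t = ν + Qs ≤ x`: the middle summand at `t` and the factored
summand at `(ν, s)` agree, except when `Q² ∣ t²+1`, where they differ by at most `6` (each side has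
at most three terms, as `t²+1 ≤ x²+1 < Q⁴`; `|jacobiSym| ≤ 1` is the tree's
`SiegelZero.abs_jacobiSym_cast_le_one`). [folklore] -/
theorem abs_inner_sub_le {Q x : ℕ} (hQ : Q.Prime) (hQ2 : Q ≠ 2) (hx : 1 ≤ x) (hxQ : x < Q ^ 2)
    (ν : ℕ) (hν : ν ∈ (range Q).filter (fun ν : ℕ => Q ∣ ν ^ 2 + 1))
    (s : ℕ) (hs : s ∈ (range (x + 1)).filter (fun s : ℕ => ν + Q * s ≤ x)) :
    |∑ Q' ∈ (((ν + Q * s) ^ 2 + 1).primeFactors).filter (fun Q' : ℕ => Q < Q'),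
        (jacobiSym (Q : ℤ) Q' : ℝ) -
      (jacobiSym (((ν ^ 2 + 1) / Q + 2 * ν * s : ℕ) : ℤ) Q : ℝ) *
        ∑ Q' ∈ ((((ν + Q * s) ^ 2 + 1) / Q).primeFactors).filter (fun Q' : ℕ => Q < Q'),
          (jacobiSym ((((ν + Q * s) ^ 2 + 1) / Q / Q' : ℕ) : ℤ) Q : ℝ)| ≤
      6 * (if Q ∣ ((ν + Q * s) ^ 2 + 1) / Q then 1 else 0 : ℝ) := by
  have hν' : Q ∣ ν ^ 2 + 1 := (Finset.mem_filter.mp hν).2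
  split_ifs with hex
  · have hn : (ν + Q * s) ^ 2 + 1 < Q ^ 4 := by
      have h1 : (ν + Q * s) ^ 2 ≤ x ^ 2 := Nat.pow_le_pow_left (Finset.mem_filter.mp hs).2 2
      have h2 : (x + 1) ^ 2 ≤ Q ^ 4 :=
        calc (x + 1) ^ 2 ≤ (Q ^ 2) ^ 2 := Nat.pow_le_pow_left hxQ 2
          _ = Q ^ 4 := by ring
      nlinarith
    have h1 := abs_sum_le_three (fun Q' => abs_jacobiSym_cast_le_one (Q : ℤ) Q')
      (card_filter_primeFactors_le_three hQ.two_le hn)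
    have h2 := abs_sum_le_three
      (fun Q' => abs_jacobiSym_cast_le_one ((((ν + Q * s) ^ 2 + 1) / Q / Q' : ℕ) : ℤ) Q)
      (card_filter_primeFactors_le_three hQ.two_le ((Nat.div_le_self _ Q).trans_lt hn))
    have h3 := abs_jacobiSym_cast_le_one (((ν ^ 2 + 1) / Q + 2 * ν * s : ℕ) : ℤ) Q
    have h4 := mul_le_mul h3 h2 (abs_nonneg _) zero_le_one
    refine (abs_sub _ _).trans ?_
    rw [abs_mul]
    linarith
  · rw [inner_sum_eq hQ hQ2 hν' hex, sub_self, abs_zero, mul_zero]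

/-- **Root-progression reindexing.** For a prime `Q`, `t ↦ (t mod Q, t div Q)` is a bijection from
`{1 ≤ t ≤ x : Q ∣ t²+1}` onto `{(ν, s) : ν < Q, Q ∣ ν²+1, s ≤ x, ν + Qs ≤ x}` with inverse
`(ν, s) ↦ ν + Qs` (`ν ≥ 1` automatically, as `Q ∤ 1`). [folklore] -/
theorem sum_filter_Icc_eq_sum_roots (Q x : ℕ) (hQ : Q.Prime) (φ : ℕ → ℝ) :
    ∑ t ∈ (Icc 1 x).filter (fun t : ℕ => Q ∣ t ^ 2 + 1), φ t =
      ∑ ν ∈ (range Q).filter (fun ν : ℕ => Q ∣ ν ^ 2 + 1),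
        ∑ s ∈ (range (x + 1)).filter (fun s : ℕ => ν + Q * s ≤ x), φ (ν + Q * s) := by
  have hQ0 : 0 < Q := hQ.pos
  have hprod : ∑ ν ∈ (range Q).filter (fun ν : ℕ => Q ∣ ν ^ 2 + 1),
      ∑ s ∈ (range (x + 1)).filter (fun s : ℕ => ν + Q * s ≤ x), φ (ν + Q * s) =
      ∑ p ∈ (((range Q).filter (fun ν : ℕ => Q ∣ ν ^ 2 + 1)) ×ˢ range (x + 1)).filter
        (fun p : ℕ × ℕ => p.1 + Q * p.2 ≤ x), φ (p.1 + Q * p.2) := by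
    symm
    rw [Finset.sum_filter, Finset.sum_product]
    refine Finset.sum_congr rfl fun ν _ => ?_
    rw [Finset.sum_filter]
  rw [hprod]
  refine Finset.sum_nbij' (fun t => (t % Q, t / Q)) (fun p => p.1 + Q * p.2) ?_ ?_ ?_ ?_ ?_
  · intro t ht
    simp only [Finset.mem_filter, Finset.mem_Icc] at ht
    simp only [Finset.mem_filter, Finset.mem_product, Finset.mem_range, Nat.mod_add_div]
    have h := dvd_sq_add_one_iff Q (t % Q) (t / Q)
    rw [Nat.mod_add_div] at h
    exact ⟨⟨⟨Nat.mod_lt _ hQ0, h.mp ht.2⟩,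
      Nat.lt_succ_of_le ((Nat.div_le_self _ _).trans ht.1.2)⟩, ht.1.2⟩
  · intro p hp
    simp only [Finset.mem_filter, Finset.mem_product, Finset.mem_range] at hp
    simp only [Finset.mem_filter, Finset.mem_Icc]
    refine ⟨⟨?_, hp.2⟩, (dvd_sq_add_one_iff Q p.1 p.2).mpr hp.1.1.2⟩
    rcases Nat.eq_zero_or_pos p.1 with h0 | h0
    · exact absurd (by simpa [h0] using hp.1.1.2 : Q = 1) hQ.one_lt.ne'
    · omega
  · exact fun t _ => Nat.mod_add_div t Q
  · intro p hp
    simp only [Finset.mem_filter, Finset.mem_product, Finset.mem_range] at hp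
    refine Prod.ext ?_ ?_
    · simp [Nat.mod_eq_of_lt hp.1.1.1]
    · simp [Nat.add_mul_div_left _ _ hQ0, Nat.div_eq_of_lt hp.1.1.1]
  · exact fun t _ => by simp only [Nat.mod_add_div]

/-- **Exceptional count.** For a prime `Q` with `x < Q²`, at most two `t ∈ [1, x]` with `Q ∣ t²+1`
have `Q ∣ (t²+1)/Q` (i.e. `Q² ∣ t²+1`): `[1, x]` lies in one period and `ρ(Q²) ≤ 2`
(tree: `Iwaniec1978.card_filter_Ico_dvd_sq_add_one`, `rho_primePow_le_two`). [folklore] -/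
theorem card_exceptional_le_two {Q x : ℕ} (hQ : Q.Prime) (hxQ : x < Q ^ 2) :
    (((Icc 1 x).filter (fun t : ℕ => Q ∣ t ^ 2 + 1)).filter
        (fun t : ℕ => Q ∣ (t ^ 2 + 1) / Q)).card ≤ 2 := by
  calc _ ≤ ((Ico 1 (1 + Q ^ 2)).filter (fun t : ℕ => Q ^ 2 ∣ t ^ 2 + 1)).card := by
        refine Finset.card_le_card fun t ht => ?_
        simp only [Finset.mem_filter, Finset.mem_Icc, Finset.mem_Ico] at ht ⊢
        refine ⟨⟨ht.1.1.1, by omega⟩, ?_⟩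
        rw [sq Q]
        exact Nat.mul_dvd_of_dvd_div ht.1.2 ht.2
    _ = Literature.NumberTheory.Sieve.Iwaniec1978.rho (Q ^ 2) :=
        Literature.NumberTheory.Sieve.Iwaniec1978.card_filter_Ico_dvd_sq_add_one (Q ^ 2) 1
    _ ≤ 2 := Literature.NumberTheory.Sieve.Iwaniec1978.rho_primePow_le_two hQ (by norm_num)

/-- Abstract bookkeeping: termwise bounds on a double sum add up. [folklore] -/
theorem abs_sum_sum_sub_le {A : Finset ℕ} {S : ℕ → Finset ℕ} {g h e : ℕ → ℕ → ℝ}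
    (hb : ∀ ν ∈ A, ∀ s ∈ S ν, |g ν s - h ν s| ≤ e ν s) :
    |∑ ν ∈ A, ∑ s ∈ S ν, g ν s - ∑ ν ∈ A, ∑ s ∈ S ν, h ν s| ≤ ∑ ν ∈ A, ∑ s ∈ S ν, e ν s := by
  rw [← Finset.sum_sub_distrib]
  refine (Finset.abs_sum_le_sum_abs _ _).trans (Finset.sum_le_sum fun ν hν => ?_)
  rw [← Finset.sum_sub_distrib]
  exact (Finset.abs_sum_le_sum_abs _ _).trans (Finset.sum_le_sum fun s hs => hb ν hν s hs)

/-- **Per prime `Q`.** For an odd prime `Q` with `x < Q²` (`x ≥ 1`), the `t`-sum of the middle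
summands and the `(ν, s)`-sum of the factored summands differ by at most `12 = 6 · 2`. [folklore] -/
theorem perQ_bound {Q x : ℕ} (hQ : Q.Prime) (hQ2 : Q ≠ 2) (hx : 1 ≤ x) (hxQ : x < Q ^ 2) :
    |(∑ t ∈ Icc 1 x, if Q ∣ t ^ 2 + 1 then
          ∑ Q' ∈ ((t ^ 2 + 1).primeFactors).filter (fun Q' : ℕ => Q < Q'),
            (jacobiSym (Q : ℤ) Q' : ℝ) else 0) -
        ∑ ν ∈ (range Q).filter (fun ν : ℕ => Q ∣ ν ^ 2 + 1),
          ∑ s ∈ (range (x + 1)).filter (fun s : ℕ => ν + Q * s ≤ x),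
            (jacobiSym (((ν ^ 2 + 1) / Q + 2 * ν * s : ℕ) : ℤ) Q : ℝ) *
              ∑ Q' ∈ ((((ν + Q * s) ^ 2 + 1) / Q).primeFactors).filter (fun Q' : ℕ => Q < Q'),
                (jacobiSym ((((ν + Q * s) ^ 2 + 1) / Q / Q' : ℕ) : ℤ) Q : ℝ)| ≤ 12 := by
  rw [← Finset.sum_filter, sum_filter_Icc_eq_sum_roots Q x hQ]
  refine (abs_sum_sum_sub_le fun ν hν s hs => abs_inner_sub_le hQ hQ2 hx hxQ ν hν s hs).trans ?_
  rw [← sum_filter_Icc_eq_sum_roots Q x hQ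
      (fun t => 6 * (if Q ∣ (t ^ 2 + 1) / Q then 1 else 0 : ℝ)),
    ← Finset.mul_sum, Finset.sum_boole]
  have h2 := (Nat.cast_le (α := ℝ)).mpr (card_exceptional_le_two hQ hxQ)
  push_cast at h2
  linarith

/-- **Exchange of `Σ_t` and `Σ_Q`, at one `t`.** Unfolding the pair filter of the middle sum and
indexing the smaller prime by `F = {Q ≤ x prime : x^θ < Q ≤ x^{θ′}}` (`x^{θ′} ≤ x` as `θ′ ≤ 1 ≤ x`):
`Σ_{(Q,Q′) ∈ pf², x^θ<Q≤x^{θ′}, Q<Q′} (Q|Q′) = Σ_{Q ∈ F} [Q ∣ t²+1] · Σ_{Q′ ∈ pf, Q<Q′} (Q|Q′)`.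
[folklore] -/
theorem middle_inner_eq (x t : ℕ) (θ θ' : ℝ) (hx : 1 ≤ x) (hθ' : θ' ≤ 1) :
    ∑ q ∈ ((t ^ 2 + 1).primeFactors ×ˢ (t ^ 2 + 1).primeFactors).filter
        (fun q : ℕ × ℕ => (x : ℝ) ^ θ < (q.1 : ℝ) ∧ (q.1 : ℝ) ≤ (x : ℝ) ^ θ' ∧ q.1 < q.2),
        (jacobiSym (q.1 : ℤ) q.2 : ℝ) =
      ∑ Q ∈ (range (x + 1)).filter
          (fun Q : ℕ => Q.Prime ∧ (x : ℝ) ^ θ < (Q : ℝ) ∧ (Q : ℝ) ≤ (x : ℝ) ^ θ'),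
        if Q ∣ t ^ 2 + 1 then
          ∑ Q' ∈ ((t ^ 2 + 1).primeFactors).filter (fun Q' : ℕ => Q < Q'),
            (jacobiSym (Q : ℤ) Q' : ℝ) else 0 := by
  have hxx : (x : ℝ) ^ θ' ≤ x := by
    have h := Real.rpow_le_rpow_of_exponent_le (x := (x : ℝ)) (by exact_mod_cast hx) hθ'
    rwa [Real.rpow_one] at h
  have hF : (t ^ 2 + 1).primeFactors.filter
      (fun Q : ℕ => (x : ℝ) ^ θ < (Q : ℝ) ∧ (Q : ℝ) ≤ (x : ℝ) ^ θ') =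
      ((range (x + 1)).filter
        (fun Q : ℕ => Q.Prime ∧ (x : ℝ) ^ θ < (Q : ℝ) ∧ (Q : ℝ) ≤ (x : ℝ) ^ θ')).filter
        (fun Q : ℕ => Q ∣ t ^ 2 + 1) := by
    ext Q
    simp only [Finset.mem_filter, Nat.mem_primeFactors, Finset.mem_range]
    exact ⟨fun ⟨⟨hp, hd, _⟩, h1, h2⟩ =>
        ⟨⟨Nat.lt_succ_of_le (by exact_mod_cast h2.trans hxx), hp, h1, h2⟩, hd⟩,
      fun ⟨⟨_, hp, h1, h2⟩, hd⟩ => ⟨⟨hp, hd, Nat.succ_ne_zero _⟩, h1, h2⟩⟩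
  rw [← Finset.sum_filter, ← hF, Finset.sum_filter, Finset.sum_product, Finset.sum_filter]
  refine Finset.sum_congr rfl fun Q _ => ?_
  rw [Finset.sum_filter]
  split_ifs with h
  · refine Finset.sum_congr rfl fun Q' _ => ?_
    by_cases h' : Q < Q'
    · rw [if_pos ⟨h.1, h.2, h'⟩, if_pos h']
    · rw [if_neg (fun hh => h' hh.2.2), if_neg h']
  · exact Finset.sum_eq_zero fun Q' _ => if_neg (fun hh => h ⟨hh.1, hh.2.1⟩)

/-- `x^θ < Q` with `θ > 1/2` and `x ≥ 1` forces `x < Q²` (THE use of `1/2 < θ`). [folklore] -/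
theorem lt_sq_of_rpow_lt {x Q : ℕ} {θ : ℝ} (hθ : 1 / 2 < θ) (hx : 1 ≤ x)
    (hQ : (x : ℝ) ^ θ < Q) : x < Q ^ 2 := by
  have hx1 : (1 : ℝ) ≤ x := by exact_mod_cast hx
  have h0 : (0 : ℝ) ≤ (x : ℝ) ^ θ := Real.rpow_nonneg (by linarith) θ
  have h1 : (x : ℝ) ≤ (x : ℝ) ^ θ * (x : ℝ) ^ θ := by
    rw [← Real.rpow_add (by linarith)]
    have h := Real.rpow_le_rpow_of_exponent_le hx1 (show (1 : ℝ) ≤ θ + θ by linarith)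
    rwa [Real.rpow_one] at h
  have h2 : (x : ℝ) ^ θ * (x : ℝ) ^ θ < (Q : ℝ) * Q := mul_lt_mul'' hQ hQ h0 h0
  exact_mod_cast (show (x : ℝ) < (Q : ℝ) ^ 2 by nlinarith)

/-- `#F ≤ x^{θ′} + 1`. [folklore] -/
theorem card_F_le (x : ℕ) (θ θ' : ℝ) :
    ((((range (x + 1)).filter
        (fun Q : ℕ => Q.Prime ∧ (x : ℝ) ^ θ < (Q : ℝ) ∧ (Q : ℝ) ≤ (x : ℝ) ^ θ')).card : ℕ) : ℝ)
      ≤ (x : ℝ) ^ θ' + 1 := by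
  have h0 : (0 : ℝ) ≤ (x : ℝ) ^ θ' := Real.rpow_nonneg (Nat.cast_nonneg x) θ'
  calc _ ≤ ((range (⌊(x : ℝ) ^ θ'⌋₊ + 1)).card : ℝ) := by
        refine mod_cast Finset.card_le_card fun Q hQ => ?_
        simp only [Finset.mem_filter, Finset.mem_range] at hQ ⊢
        exact Nat.lt_succ_of_le (Nat.le_floor hQ.2.2.2)
    _ ≤ _ := by rw [Finset.card_range]; push_cast; linarith [Nat.floor_le h0]

/-- **The dictionary, summed.** For `1/2 < θ`, `θ′ ≤ 1`, `x ≥ 4`: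
`|middleSum θ θ′ x − factoredSum θ θ′ x| ≤ 12 (x^{θ′} + 1)`. [folklore] -/
theorem abs_middle_sub_factored_le {x : ℕ} {θ θ' : ℝ} (hθ : 1 / 2 < θ) (hθ' : θ' ≤ 1)
    (hx : 4 ≤ x) :
    |(∑ t ∈ Finset.Icc 1 x,
        ∑ q ∈ ((t ^ 2 + 1).primeFactors ×ˢ (t ^ 2 + 1).primeFactors).filter
          (fun q : ℕ × ℕ => (x : ℝ) ^ θ < (q.1 : ℝ) ∧ (q.1 : ℝ) ≤ (x : ℝ) ^ θ' ∧ q.1 < q.2),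
          (jacobiSym (q.1 : ℤ) q.2 : ℝ)) -
      ∑ Q ∈ (Finset.range (x + 1)).filter
          (fun Q : ℕ => Q.Prime ∧ (x : ℝ) ^ θ < (Q : ℝ) ∧ (Q : ℝ) ≤ (x : ℝ) ^ θ'),
        ∑ ν ∈ (Finset.range Q).filter (fun ν : ℕ => Q ∣ ν ^ 2 + 1),
          ∑ s ∈ (Finset.range (x + 1)).filter (fun s : ℕ => ν + Q * s ≤ x),
            (jacobiSym (((ν ^ 2 + 1) / Q + 2 * ν * s : ℕ) : ℤ) Q : ℝ) *
              ∑ Q' ∈ ((((ν + Q * s) ^ 2 + 1) / Q).primeFactors).filter (fun Q' : ℕ => Q < Q'),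
                (jacobiSym ((((ν + Q * s) ^ 2 + 1) / Q / Q' : ℕ) : ℤ) Q : ℝ)|
      ≤ 12 * ((x : ℝ) ^ θ' + 1) := by
  have hx1 : 1 ≤ x := by omega
  rw [Finset.sum_congr rfl fun t _ => middle_inner_eq x t θ θ' hx1 hθ', Finset.sum_comm,
    ← Finset.sum_sub_distrib]
  refine ((Finset.abs_sum_le_sum_abs _ _).trans
    (Finset.sum_le_sum (g := fun _ => (12 : ℝ)) fun Q hQ => ?_)).trans ?_
  · obtain ⟨-, hp, hlt, -⟩ := Finset.mem_filter.mp hQ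
    have hxQ : x < Q ^ 2 := lt_sq_of_rpow_lt hθ hx1 hlt
    exact perQ_bound hp (by rintro rfl; norm_num at hxQ; omega) hx1 hxQ
  · rw [Finset.sum_const, nsmul_eq_mul]
    have := card_F_le x θ θ'
    linarith

/-- `x^a = o(x)` along `ℕ` for `a < 1`. [folklore] -/
theorem rpow_isLittleO_natCast {a : ℝ} (ha : a < 1) :
    (fun x : ℕ => (x : ℝ) ^ a) =o[atTop] fun x : ℕ => (x : ℝ) := by
  have h : (fun x : ℝ => x ^ a) =o[atTop] fun x : ℝ => x := by
    refine (isLittleO_iff_tendsto' ?_).mpr ?_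
    · filter_upwards [eventually_gt_atTop 0] with x hx h0 using absurd h0 hx.ne'
    · refine (tendsto_rpow_neg_atTop (by linarith : 0 < 1 - a)).congr' ?_
      filter_upwards [eventually_gt_atTop 0] with x hx
      rw [neg_sub, Real.rpow_sub_one hx.ne']
  exact h.comp_tendsto tendsto_natCast_atTop_atTop

end DigitReparam

open DigitReparam in
/-- **stub_digitReparametrisation** (registered stub of the skeleton
`Cruxes/SplitBlockJacobi/Lines/split-mass-middle-prime.lean`; the DICTIONARY, elementary):
`FactoredMiddleCancels → MiddlePrimeJacobi`.  For `1/2 < θ < θ′ < 1` and `x ≥ 4` the middle-prime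
sum `M_{θ,θ′}(x)` and the factored sum (in `(Q, ν, s)`-currency, `t = ν + Qs`, `ν² ≡ −1 (mod Q)`)
differ by at most `12 (x^{θ′} + 1)` (`DigitReparam.abs_middle_sub_factored_le`: reindexing along
root progressions; reciprocity for `Q ≡ 1 (mod 4)`, `(R|Q) = (c_ν + 2νs|Q)`, `(m|Q)² = 1` off the
`≤ 2`-per-`Q` exceptional `t` with `Q² ∣ t²+1`), and `x^{θ′} = o(x)`; so `factored = o(x)` gives
`middle = o(x)`. [folklore] -/
theorem stub_digitReparametrisation :
    (∀ θ θ' : ℝ, 1 / 2 < θ → θ < θ' → θ' < 1 →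
      (fun x : ℕ =>
        ∑ Q ∈ (Finset.range (x + 1)).filter
            (fun Q : ℕ => Q.Prime ∧ (x : ℝ) ^ θ < (Q : ℝ) ∧ (Q : ℝ) ≤ (x : ℝ) ^ θ'),
          ∑ ν ∈ (Finset.range Q).filter (fun ν : ℕ => Q ∣ ν ^ 2 + 1),
            ∑ s ∈ (Finset.range (x + 1)).filter (fun s : ℕ => ν + Q * s ≤ x),
              (jacobiSym (((ν ^ 2 + 1) / Q + 2 * ν * s : ℕ) : ℤ) Q : ℝ) *
                ∑ Q' ∈ ((((ν + Q * s) ^ 2 + 1) / Q).primeFactors).filter (fun Q' : ℕ => Q < Q'),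
                  (jacobiSym ((((ν + Q * s) ^ 2 + 1) / Q / Q' : ℕ) : ℤ) Q : ℝ))
        =o[Filter.atTop] fun x : ℕ => (x : ℝ)) →
    ∀ θ θ' : ℝ, 1 / 2 < θ → θ < θ' → θ' < 1 →
      (fun x : ℕ => ∑ t ∈ Finset.Icc 1 x,
          ∑ q ∈ ((t ^ 2 + 1).primeFactors ×ˢ (t ^ 2 + 1).primeFactors).filter
            (fun q : ℕ × ℕ => (x : ℝ) ^ θ < (q.1 : ℝ) ∧ (q.1 : ℝ) ≤ (x : ℝ) ^ θ' ∧ q.1 < q.2),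
            (jacobiSym (q.1 : ℤ) q.2 : ℝ))
        =o[Filter.atTop] fun x : ℕ => (x : ℝ) := by
  intro hfac θ θ' hθ hθθ' hθ'1
  have hF := hfac θ θ' hθ hθθ' hθ'1
  rw [Asymptotics.isLittleO_iff] at hF ⊢
  intro c hc
  have hpow := rpow_isLittleO_natCast hθ'1
  rw [Asymptotics.isLittleO_iff] at hpow
  filter_upwards [hF (half_pos hc), hpow (show 0 < c / 48 by positivity),
    Filter.eventually_ge_atTop 4] with x hxF hxpow hx
  have h1 := abs_middle_sub_factored_le (θ := θ) hθ hθ'1.le hx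
  have h2 := (abs_sub_abs_le_abs_sub _ _).trans h1
  have hx1 : (1 : ℝ) ≤ (x : ℝ) ^ θ' :=
    Real.one_le_rpow (by exact_mod_cast (show 1 ≤ x by omega)) (by linarith)
  rw [Real.norm_eq_abs, Real.norm_eq_abs, Nat.abs_cast] at hxF hxpow ⊢
  rw [abs_of_nonneg (by linarith : (0 : ℝ) ≤ (x : ℝ) ^ θ')] at hxpow
  linarith

end Summit.Parity.BatemanHorn.Cruxes.SplitBlockJacobi.SplitMassMiddlePrime

end
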